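import Summits.HodgeConjecture.HodgeConjecture.Cruxes.BlochSeedDiscOne.Anchor
import Summits.Ventures.HSemireg.Pad4TowerSeedB1Odd
import Summits.Ventures.HSemireg.Pad4TowerSeedB1D2S4
import Summits.Ventures.HSemireg.Pad4TowerTwistedWindows
import Summits.Ventures.HSemireg.Pad4TowerTorusBlindBase

/-!
# Negation lens on crux `BlochSeedDiscOne` (stmt-HodgeConjecture-18881) — FLIP-CROSSFIRE and the PURE-PERMUTATION CELL

Sketch of the ideator line `flip-crossfire-s4cell` (plan-lens-HodgeAV-negation g0, 2026-08-28). HYPOTHESIS-FORM seeds +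
small PROVED structural lemmas + `decide` probes; NO `sorry`, NO binder left: flip-covariance of RULE D (L-cov) `RuleDFlipCovariant` is now
PROVED (`ruleDFlipCovariant_holds`) as the `η = Δ²` instance of g53's landed `ruleDMu4Closed_phaseImage` (`Pad4TowerTorusBlindBase`, 1006 p650300;
LEMMA T = 1014 p653647), and the W20 seed is the tree's `SeedB1Diamond8D2S4All` (typer-2 (V), 992 p645174). [rev 3, g2 2026-08-28: critic L3 N4
hygiene — Anchor import (R16.15), binder discharged, local seed∕`Sub`∕mono∕`StaticAll` replaced by the tree's `MConfig.sub`, `ruleDMu4N_mono`,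
`MConfig.StaticAll` (same bodies); `ruleDMu4Closed_satD2` and `crossfire_is_kill` lose the binder hypothesis, every other statement is unchanged
up to these substitutions.]
NOTHING HERE SAYS THAT HC ∕ HC_CM ∕ HC_AV ∕ H2 HOLDS OR FAILS; the crux `BlochSeedDiscOne` is neither proved nor refuted here.

THE LINE IN ONE SENTENCE. Assume STUB R's PAD-4 seed design exists with support `C ⊆ ◇₈`; everything the census closed is a
SYMMETRIC cell, and every ingredient of the (H1)+(E1)-static screen EXCEPT the kill families `X±`, `A2I±`, `FC1` survives
`G`-saturation of the support (RULE D, FC-CORE, InDiamond are monotone∕covariant; (A1), `μ ≠ 0`, positivity survive by the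
averaging theorems `permInvariant_wlog` ∕ `d2Invariant_wlog`); hence the census FORCES: the `⟨Δ²⟩×S₄`-saturation of a survivor is
RULE-D-closed, FC-CORE, (A1)-feasible and KILLED — the kill instance straddles the survivor and a flipped∕permuted copy of it
(CROSSFIRE). By g53's decoding of the ◇₈ peel (§5e: the only two 2-literal kill motifs are the A2I⁻ SWAP KILL, mate `(0, τ)`, and
the X⁺ CEILING KILL, mate `(Δ², 1)` or `(Δ², τ)`), the maximal sub-symmetries of `⟨Δ²⟩×S₄` that DISARM a motif are typed below;
the pure permutation group `S₄` (no flip) is the unique index-2 one that keeps every transposition and loses `Δ²` — the cell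
never run (W8: flat ◇₆∕◇₈ out of reach; W1 two phases only; E10 needs even flips; W14∕W14d∕LINE 4 need `Δ` or `Δ²`).
-/

set_option linter.dupNamespace false -- `HodgeConjecture.HodgeConjecture` is the tree's Summit/Sub layout (D-0017)

namespace Summit.HodgeConjecture.HodgeConjecture.Cruxes.BlochSeedDiscOne.FlipCrossfire

open Finset Summit.Ventures.HSemireg.Pad4Tower

/-! ## §1 Saturation of a two-level support by the total flip `Δ²` and levelwise inclusion -/

/-! (levelwise inclusion = the tree's `MConfig.sub`, `Pad4TowerRuleDMu4Dual`; RULE-D monotonicity = the tree's `ruleDMu4N_mono` ∕ `ruleDMu4P_mono` there.) -/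

/-- the `Δ²`-SATURATION of a support: adjoin the total flip `β ↦ −β` of every cell, at its own level. -/
def satD2 (C : MConfig) : MConfig :=
  ⟨C.lower ∪ C.lower.image MCell.delta2, C.upper ∪ C.upper.image MCell.delta2⟩

theorem sub_satD2 (C : MConfig) : C.sub (satD2 C) :=
  ⟨subset_union_left, subset_union_left⟩

/-- one level of the saturation is `Δ²`-closed (Δ² is an involution). -/
theorem d2Closed_sat (S : Finset MCell) : D2Closed (S ∪ S.image MCell.delta2) := by
  intro Z hZ
  rcases mem_union.1 hZ with h | h
  · exact mem_union.2 (Or.inr (mem_image_of_mem _ h))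
  · obtain ⟨Y, hY, rfl⟩ := mem_image.1 h
    rw [MCell.delta2_delta2]
    exact mem_union.2 (Or.inl hY)

theorem satD2_d2Closed (C : MConfig) : D2Closed (satD2 C).lower ∧ D2Closed (satD2 C).upper :=
  ⟨d2Closed_sat _, d2Closed_sat _⟩

/-- one level of the saturation stays `S₄`-closed (Δ² commutes with the factor permutations, `MCell.delta2_perm`). -/
theorem permClosed_sat {S : Finset MCell} (hS : PermClosed S) : PermClosed (S ∪ S.image MCell.delta2) := by
  intro σ Z hZ
  rcases mem_union.1 hZ with h | h
  · exact mem_union.2 (Or.inl (hS σ Z h))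
  · obtain ⟨Y, hY, rfl⟩ := mem_image.1 h
    refine mem_union.2 (Or.inr ?_)
    rw [← MCell.delta2_perm]
    exact mem_image_of_mem _ (hS σ Y hY)

theorem satD2_permClosed {C : MConfig} (hl : PermClosed C.lower) (hu : PermClosed C.upper) :
    PermClosed (satD2 C).lower ∧ PermClosed (satD2 C).upper :=
  ⟨permClosed_sat hl, permClosed_sat hu⟩

/-- the flip preserves `|charge|`. -/
theorem absCharge_delta2 (Z : MCell) (f : Fin 4) : absCharge (Z.delta2 f) = absCharge (Z f) := by
  rw [MCell.delta2_apply]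
  show |(-(Z f).2.1) - (-(Z f).2.2)| = |(Z f).2.1 - (Z f).2.2|
  rw [show -(Z f).2.1 - -(Z f).2.2 = -((Z f).2.1 - (Z f).2.2) by ring, abs_neg]

/-- `◇_h` is flip-invariant letterwise. -/
theorem inDiamond_delta2 {h : ℤ} {Z : MCell} (hZ : MCell.InDiamond h Z) : MCell.InDiamond h Z.delta2 := by
  intro f
  have hx := hZ f
  have ea := absCharge_delta2 Z f
  have e1 : (Z.delta2 f).1 = (Z f).1 := by rw [MCell.delta2_apply]
  have eax : ((Z.delta2 f).2 = (0, 0) ∨ AxisPt (Z.delta2 f)) ↔ ((Z f).2 = (0, 0) ∨ AxisPt (Z f)) := by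
    rw [MCell.delta2_apply]; simp [AxisPt, Prod.ext_iff]
  refine ⟨eax.2 hx.1, ?_, ?_, ?_⟩
  · rw [ea, e1]; exact hx.2.1
  · rw [ea, e1]; exact hx.2.2.1
  · rw [ea, e1]; exact hx.2.2.2

theorem inDiamond_satD2 {h : ℤ} {C : MConfig} (hC : C.InDiamond h) : (satD2 C).InDiamond h := by
  refine ⟨fun Z hZ => ?_, fun P hP => ?_⟩
  · rcases mem_union.1 hZ with hm | hm
    · exact hC.1 Z hm
    · obtain ⟨Y, hY, rfl⟩ := mem_image.1 hm; exact inDiamond_delta2 (hC.1 Y hY)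
  · rcases mem_union.1 hP with hm | hm
    · exact hC.2 P hm
    · obtain ⟨Y, hY, rfl⟩ := mem_image.1 hm; exact inDiamond_delta2 (hC.2 Y hY)

/-! ## §2 What survives saturation: FC-CORE (monotone), RULE D (monotone + covariant) -/

theorem hasSignedFC_mono {C C' : MConfig} (h : C.sub C') {κ : Fin 16} {s : ℤ} (hC : C.HasSignedFC κ s) :
    C'.HasSignedFC κ s := by
  rcases hC with ⟨Z, hZ, hr⟩ | ⟨P, hP, hr⟩
  · exact Or.inl ⟨Z, h.1 hZ, hr⟩
  · exact Or.inr ⟨P, h.2 hP, hr⟩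

/-- **FC-CORE IS MONOTONE in the support** (a presence block). -/
theorem fcCoreBlock_mono {C C' : MConfig} (h : C.sub C') (hC : C.FCCoreBlock) : C'.FCCoreBlock := by
  rcases hC with ⟨s, hs, h0, h15, h3, h5, h6, h9, h10, h12⟩ | ⟨t, ht, h1, h2, h4, h8, h7, h11, h13, h14⟩
  · exact Or.inl ⟨s, hs, hasSignedFC_mono h h0, hasSignedFC_mono h h15, hasSignedFC_mono h h3, hasSignedFC_mono h h5,
      hasSignedFC_mono h h6, hasSignedFC_mono h h9, hasSignedFC_mono h h10, hasSignedFC_mono h h12⟩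
  · exact Or.inr ⟨t, ht, hasSignedFC_mono h h1, hasSignedFC_mono h h2, hasSignedFC_mono h h4, hasSignedFC_mono h h8,
      hasSignedFC_mono h h7, hasSignedFC_mono h h11, hasSignedFC_mono h h13, hasSignedFC_mono h h14⟩

/-! (L-mono) **RULE D IS MONOTONE in the support** — served coordinates and (r2a) covers are PRESENCE conditions, so a cell that passes
the diagonal criterion in `C` passes it in every levelwise larger `C'`: the tree's `ruleDMu4N_mono` ∕ `ruleDMu4P_mono` (`Pad4TowerRuleDMu4Dual` §Mono),
used below by name. -/

/-- (L-cov) **RULE D IS FLIP-COVARIANT** — the statement (kept verbatim from rev 2, where it was a displayed binder). -/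
def RuleDFlipCovariant : Prop :=
  ∀ C : MConfig, RuleDMu4Closed C → RuleDMu4Closed ⟨C.lower.image MCell.delta2, C.upper.image MCell.delta2⟩

/-- **(L-cov) PROVED** [rev 3]: the `η = d2Vec` instance of g53's landed `ruleDMu4Closed_phaseImage` (`Pad4TowerTorusBlindBase`, 1006 p650300;
`MCell.delta2 = MCell.phase d2Vec` and `C.phaseImage d2Vec = ⟨C.lower.image MCell.delta2, C.upper.image MCell.delta2⟩` definitionally). -/
theorem ruleDFlipCovariant_holds : RuleDFlipCovariant := fun C hR =>
  (ruleDMu4Closed_phaseImage (C := C) (η := d2Vec)).2 hR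

/-- hence **RULE-D CLOSURE SURVIVES `Δ²`-SATURATION** (from (L-mono) + (L-cov), both PROVED; unconditional since rev 3). -/
theorem ruleDMu4Closed_satD2 {C : MConfig} (hR : RuleDMu4Closed C) : RuleDMu4Closed (satD2 C) := by
  have hR' := ruleDFlipCovariant_holds C hR
  have s1 : C.sub (satD2 C) := sub_satD2 C
  have s2 : MConfig.sub ⟨C.lower.image MCell.delta2, C.upper.image MCell.delta2⟩ (satD2 C) :=
    ⟨subset_union_right, subset_union_right⟩
  refine ⟨fun Z hZ => ?_, fun P hP => ?_⟩
  · rcases mem_union.1 hZ with hm | hm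
    · exact ruleDMu4N_mono s1 (hR.1 Z hm)
    · exact ruleDMu4N_mono s2 (hR'.1 Z hm)
  · rcases mem_union.1 hP with hm | hm
    · exact ruleDMu4P_mono s1 (hR.2 P hm)
    · exact ruleDMu4P_mono s2 (hR'.2 P hm)

/-! ## §3 The census seed for `G′ = ⟨Δ²⟩ × S₄` (hypothesis form; LINE 4 ∕ card v4.19 row W20) and the CROSSFIRE THEOREM -/

/-! The FULL static bundle of the game of record (RULE D + FC1 + `X±` + `A2I±`) = the tree's `MConfig.StaticAll` (`Pad4TowerSeedB1D2S4` §1,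
literally `RuleDMu4Closed C ∧ FC1Mu4Closed C ∧ XresFourClosed C`, rev 2's local abbrev). -/

/-! **SEED (B1) ON THE INDEX-2 CELL `G′ = ⟨Δ²⟩ × S₄` AT ◇₈ — HYPOTHESIS FORM, machine ×2, NO proof** = the tree's
`SeedB1Diamond8D2S4All : Prop := ∀ C, C.InDiamond 8 → C.D2S4Closed → C.StaticAll → ¬ C.FCCoreBlock` (typer-2 (V) `Pad4TowerSeedB1D2S4`, 992 p645174;
card `birth-v4.md` row W20: kit j305439 `core_only` UNSAT ×2, 24 494 820 ∕ 119 054 866; `full` j310053 pending). Rev 2's local stand-in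
`SeedB1Diamond8D2S4Static` (same statement with `D2S4Closed` uncurried) is retired in its favour [rev 3]. -/

/-- **Δ²-CROSSFIRE** of a support: statically clean itself, while its flip-saturation is NOT. -/
def D2Crossfire (C : MConfig) : Prop := C.StaticAll ∧ ¬ (satD2 C).StaticAll

/-- **CROSSFIRE THEOREM (forced shape of a permutation-symmetric survivor at ◇₈).** Granted the W20 seed: every `S₄`-closed two-level
support in ◇₈ that is statically clean AND carries the FC-CORE presence block (necessary for a positive (A1)-design with `μ ≠ 0`,
`MConfig.fcCoreBlock_of_classScreen`) has a statically DEAD `Δ²`-saturation. PROVED here from §1–§2 (the seed is applied to the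
saturation directly; no covariance input needed for this statement). -/
theorem d2Crossfire_of_seed (hseed : SeedB1Diamond8D2S4All) (C : MConfig) (hU : C.InDiamond 8)
    (hl : PermClosed C.lower) (hu : PermClosed C.upper) (hS : C.StaticAll) (hF : C.FCCoreBlock) : D2Crossfire C := by
  refine ⟨hS, fun hS' => ?_⟩
  exact hseed (satD2 C) (inDiamond_satD2 hU)
    ⟨(satD2_permClosed hl hu).1, (satD2_permClosed hl hu).2, (satD2_d2Closed C).1, (satD2_d2Closed C).2⟩ hS'
    (fcCoreBlock_mono (sub_satD2 C) hF)

/-- **LOCALISATION: the crossfire is a KILL-FAMILY fire, never a RULE-D failure** (RULE D survives saturation, §2): granted the seed,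
an `S₄`-closed static-clean FC-CORE support at ◇₈ has an `FC1 ∕ X± ∕ A2I±` instance firing on `C ∪ Δ²C` — by construction one whose
presence atoms are not all in `C` (else it fired on `C`): the FLIP SUPPLIES THE MATE. [PROVED; unconditional in (L-cov) since rev 3] -/
theorem crossfire_is_kill (hseed : SeedB1Diamond8D2S4All) (C : MConfig) (hU : C.InDiamond 8)
    (hl : PermClosed C.lower) (hu : PermClosed C.upper) (hS : C.StaticAll) (hF : C.FCCoreBlock) :
    ¬ (FC1Mu4Closed (satD2 C) ∧ XresFourClosed (satD2 C)) := fun hK =>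
  (d2Crossfire_of_seed hseed C hU hl hu hS hF).2 ⟨ruleDMu4Closed_satD2 hS.1, hK.1, hK.2⟩

/-! ## §4 FIRST LEMMA of the line (the statement a prover ∕ the encoder attacks next): the PURE-PERMUTATION CELL -/

/-- **SEED CANDIDATE (B1-S₄) — the pure-permutation cell at height `h`**: no `S₄`-closed (NO flip, NO phase symmetry) two-level support in
`◇_h` that is statically clean carries the FC-CORE block. TYPED TARGET, status OPEN at every `h ≥ 6` (E9 closes `h ≤ 4`; no census
row covers it: W1 = two phases, E10 = even flips, W14∕W14d∕W20 = `Δ`∕`Δ²` present, W8 = flat ◇₆ out of reach). Its ◇₆ instance is the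
line's CHEAPEST FALSIFIER (2·C(31,4) = 62 930 orbit variables); its ◇₈ instance (2·C(48,4) = 389 160) is ≈ 2× W20's CNF. -/
def SeedB1DiamondS4Static (h : ℤ) : Prop :=
  ∀ C : MConfig, C.InDiamond h → PermClosed C.lower → PermClosed C.upper → C.StaticAll → ¬ C.FCCoreBlock

/-- the `H₁`-form (famcore W16: `H₁ = H₂ = RULE-D + {X+, A2I−}` on the `G₁` cell; whether `H₁` suffices on the `S₄` cell is part of the ask). -/
def SeedB1DiamondS4H1 (h : ℤ) : Prop :=
  ∀ C : MConfig, C.InDiamond h → PermClosed C.lower → PermClosed C.upper → C.StaticH1 → ¬ C.FCCoreBlock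

theorem seedS4Static_of_H1 {h : ℤ} (hs : SeedB1DiamondS4H1 h) : SeedB1DiamondS4Static h :=
  fun C hU hl hu hS => hs C hU hl hu ⟨hS.1, hS.2.2.2.1, hS.2.2.2.2.1⟩

/-- (B1-S₄) at ◇₈ implies the W20 seed restricted likewise (an `S₄`-closed `Δ²`-closed support is `S₄`-closed): the pure cell DOMINATES
LINE 4's cell, so an UNSAT there re-derives W20∕W14d and a SAT there is the first flip-chiral symmetric static survivor with FC-CORE. -/
theorem seedD2S4_of_seedS4 (hs : SeedB1DiamondS4Static 8) : SeedB1Diamond8D2S4All :=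
  fun C hU hG hS => hs C hU hG.1 hG.2.1 hS

/-! ## §5 The two peel motifs as elements of `W = (ℤ∕4)⁴ ⋊ S₄` and which index-2 cells disarm them (`decide`) -/

/-- an element `(η, σ)` of `W = (ℤ∕4)⁴ ⋊ S₄`, acting by `MCell.twist η σ`. -/
abbrev WElt := PVec × Equiv.Perm (Fin 4)

/-- torus part in `⟨Δ²⟩ = {0, (2,2,2,2)}`. -/
abbrev flipPart (g : WElt) : Prop := g.1 = pv 0 0 0 0 ∨ g.1 = d2Vec
/-- torus part in `⟨Δ⟩`. -/
abbrev deltaPart (g : WElt) : Prop := flipPart g ∨ g.1 = dVec ∨ g.1 = pv 3 3 3 3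
/-- number of inversions of a permutation of `Fin 4` (its parity is the sign character). -/
def inversions (σ : Equiv.Perm (Fin 4)) : ℕ :=
  (Finset.univ.filter (fun p : Fin 4 × Fin 4 => p.1 < p.2 ∧ σ p.2 < σ p.1)).card
/-- even permutation part (membership in `A₄`): an even number of inversions. Decidable by evaluation. -/
abbrev evenPerm (g : WElt) : Prop := inversions g.2 % 2 = 0

/-- THE INDEX-2 ATLAS BELOW THE TWO DEAD CELLS. Dead at ◇₈ (hence at ◇₆): `G₁ = ⟨Δ⟩ × S₄` (W14d j298438 + j302131) and
`G′ = ⟨Δ²⟩ × S₄` (W20 j305439 `core_only`). The index-2 subgroups of `G₁` other than `G′` are `C₄×A₄` and `K_χ = {(Δ^a, σ) : a ≡ sgn σ (2)}`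
(the two MINIMAL `G₁`-ORBIT-BREAKINGS); the index-2 subgroups of `G′` are `S₄` (pure: no phase at all), `S₄^χ = {(1, even)} ∪ {(Δ², odd)}` and
`⟨Δ²⟩×A₄ = C₄×A₄ ∩ K_χ ∩ G′`. The four MAXIMAL LIVE CANDIDATE CELLS (critic L3 N3: the motif-disarming criterion is a PREDICTION from g53's empirical decoding of the ◇₈ peel; census-DEAD are only `G₁`, `G′` and their overgroups) inside `G₁` are therefore `C₄×A₄`, `K_χ`, `S₄`, `S₄^χ`; none contains `S₄`
together with a phase, so W14d∕W20∕E10 do not touch them. Burnside orbit counts (two levels; script `burnside_atlas.py`, validated on the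
census numbers 97 660 ∕ 195 160 ∕ 389 160 ∕ 2 051 250 ∕ 8 201 250 at ◇₈): ◇₆∕◇₈∕◇₁₀ — `C₄×A₄` 26 120 ∕ 172 150 ∕ 793 362, `K_χ` 26 130 ∕
172 160 ∕ 793 362, `S₄` 62 930 ∕ 389 160 ∕ 1 729 002, `S₄^χ` 52 178 ∕ 344 160 ∕ 1 586 442, `⟨Δ²⟩×A₄` 52 168 ∕ 344 150 ∕ 1 586 442 — i.e.
0.9×, 0.9×, 2×, 1.8× the W20 instance (195 160): every maximal live candidate cell is ONE kit job of tonight's size. -/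
abbrev inG1 (g : WElt) : Prop := deltaPart g
abbrev inGprime (g : WElt) : Prop := flipPart g
abbrev inC4A4 (g : WElt) : Prop := deltaPart g ∧ evenPerm g
abbrev inKchi (g : WElt) : Prop := (flipPart g ∧ evenPerm g) ∨ ((g.1 = dVec ∨ g.1 = pv 3 3 3 3) ∧ ¬ evenPerm g)
abbrev inS4 (g : WElt) : Prop := g.1 = pv 0 0 0 0
abbrev inS4chi (g : WElt) : Prop := (g.1 = pv 0 0 0 0 ∧ evenPerm g) ∨ (g.1 = d2Vec ∧ ¬ evenPerm g)
abbrev inD2A4 (g : WElt) : Prop := flipPart g ∧ evenPerm g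

/-- the three MATES that fold the ◇₈ peel's 2-literal conflicts (g53 PENCIL-B1ODD v0.4 §5e, kit j309861): M1 = A2I⁻ SWAP KILL mate
`(0, τ)`; M2a ∕ M2b = X⁺ CEILING KILL mates `(Δ², 1)` (node pair) ∕ `(Δ², τ)` (flipped pair). -/
def mateM1 : WElt := (pv 0 0 0 0, Equiv.swap 0 1)
def mateM2a : WElt := (d2Vec, 1)
def mateM2b : WElt := (d2Vec, Equiv.swap 0 1)

set_option synthInstance.maxSize 8192 in
/-- **THE MOTIF TABLE (group membership of the three mates; exact).** Both dead cells contain all three mates. Of the live candidate cells: the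
PURE cell `S₄` keeps M1 and loses BOTH ceiling mates (rigorously: `S₄` preserves the letter multiset, the sibling changes it, so pure `S₄`
NEVER supplies a ceiling sibling — every X⁺ ceiling kill becomes a genuine choice «at most one phase `u` per head `[x|y|6I+ℓ_u|8I]`»);
`C₄×A₄`, `K_χ`, `⟨Δ²⟩×A₄` keep only the node-pair ceiling mate M2a; `S₄^χ` keeps only the flipped-pair mate M2b. CAVEAT for the
`A₄`-type cells: on a cell with a REPEATED letter the `A₄`- and `S₄`-orbits coincide, so M1 stays armed there at such heads (e.g. g53's
`N[O|ℓ₋₁|ℓ₋₁|2I]`) and is disarmed only at heads with four distinct letters. No live index-2 cell contains M1's mate together with a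
ceiling mate — that conjunction characterises the dead cells. [`decide`] -/
theorem motif_table :
    (inG1 mateM1 ∧ inG1 mateM2a ∧ inG1 mateM2b) ∧ (inGprime mateM1 ∧ inGprime mateM2a ∧ inGprime mateM2b) ∧
    (inS4 mateM1 ∧ ¬ inS4 mateM2a ∧ ¬ inS4 mateM2b) ∧
    (¬ inC4A4 mateM1 ∧ inC4A4 mateM2a ∧ ¬ inC4A4 mateM2b) ∧
    (¬ inKchi mateM1 ∧ inKchi mateM2a ∧ ¬ inKchi mateM2b) ∧
    (¬ inD2A4 mateM1 ∧ inD2A4 mateM2a ∧ ¬ inD2A4 mateM2b) ∧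
    (¬ inS4chi mateM1 ∧ ¬ inS4chi mateM2a ∧ inS4chi mateM2b) := by
  unfold mateM1 mateM2a mateM2b
  refine ⟨?_, ?_, ?_, ?_, ?_, ?_, ?_⟩ <;> decide

/-! ## §6 KERNEL WITNESS OF A CROSSFIRE (LEMMA C's configuration): X⁺-clean until the flip supplies the sibling -/

/-- LEMMA C's head `Z° = [O | O | 6I+ℓ₁ | 8I]` (a `P`-cell) with its lift `q° = [O | O | 8I | 8I]` (an `N`-cell). -/
def lemmaCHead : MCell := mcellOf (0, 0, 0) (0, 0, 0) (ray (6, 0, 0) 0 1) (8, 0, 0)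
def lemmaCLift : MCell := mcellOf (0, 0, 0) (0, 0, 0) (8, 0, 0) (8, 0, 0)
/-- the two-cell configuration `{q°} ∣ {Z°}` and its `Δ²`-saturation (which adjoins the flipped sibling `[O | O | 6I+ℓ₋₁ | 8I]`). -/
def lemmaCCfg : MConfig := ⟨{lemmaCLift}, {lemmaCHead}⟩

set_option synthInstance.maxSize 8192 in
set_option synthInstance.maxHeartbeats 2000000 in -- large decidable instances, as in the family files
/-- **CROSSFIRE WITNESS.** `lemmaCCfg` lies in ◇₈ and is `X+`-closed; its `Δ²`-saturation is NOT `X+`-closed (the flip of the head is the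
sibling `n°` of g53's LEMMA C `xplus_ceiling_kill`: the kill's mate is `Δ²`). [kernel, `decide`] -/
theorem lemmaC_crossfire : lemmaCCfg.InDiamond 8 ∧ XPlusClosed lemmaCCfg ∧ ¬ XPlusClosed (satD2 lemmaCCfg) := by
  refine ⟨?_, ?_, ?_⟩ <;> decide +kernel

/-! ## §6b ENCODER SPEC FOR THE PURE-`S₄` CELL: the FC-CORE block in `S₄`-ORBIT FORM (5 presence atoms instead of 16)

On a support with both levels permutation-closed, a signed FC occurrence of one pattern of a given weight gives every pattern of that
weight with the same orbit sign (`MConfig.hasSignedFC_perm`, tree). Hence the block needs only ONE atom per `S₄`-orbit of patterns: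
even half = `{0000 : s, 1111 : s, 0011 : −s}`, odd half = `{0001 : t, 0111 : −t}`. This is the clause shape of the `S₄` cell's FC-CORE. -/

/-- even half in orbit form. -/
def FCCoreEvenOrbit (C : MConfig) (s : ℤ) : Prop := C.HasSignedFC 0 s ∧ C.HasSignedFC 15 s ∧ C.HasSignedFC 3 (-s)
/-- odd half in orbit form. -/
def FCCoreOddOrbit (C : MConfig) (t : ℤ) : Prop := C.HasSignedFC 1 t ∧ C.HasSignedFC 7 (-t)
/-- the block in orbit form. -/
def FCCoreBlockOrbit (C : MConfig) : Prop := (∃ s : ℤ, s ≠ 0 ∧ FCCoreEvenOrbit C s) ∨ (∃ t : ℤ, t ≠ 0 ∧ FCCoreOddOrbit C t)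

/-- **ORBIT FORM OF THE FC-CORE BLOCK** on an `S₄`-closed support. The eleven transporting permutations are explicit swaps; their bit
conditions are checked by `decide`. -/
theorem fcCoreBlock_iff_orbit {C : MConfig} (hl : PermClosed C.lower) (hu : PermClosed C.upper) :
    C.FCCoreBlock ↔ FCCoreBlockOrbit C := by
  constructor
  · rintro (⟨s, hs, h0, h15, h3, -, -, -, -, -⟩ | ⟨t, ht, h1, -, -, -, h7, -, -, -⟩)
    · exact Or.inl ⟨s, hs, h0, h15, h3⟩
    · exact Or.inr ⟨t, ht, h1, h7⟩
  · rintro (⟨s, hs, h0, h15, h3⟩ | ⟨t, ht, h1, h7⟩)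
    · refine Or.inl ⟨s, hs, h0, h15, h3, ?_, ?_, ?_, ?_, ?_⟩
      · exact MConfig.hasSignedFC_perm hl hu (Equiv.swap 1 2) (by decide) h3
      · exact MConfig.hasSignedFC_perm hl hu (Equiv.swap 1 3) (by decide) h3
      · exact MConfig.hasSignedFC_perm hl hu (Equiv.swap 0 2) (by decide) h3
      · exact MConfig.hasSignedFC_perm hl hu (Equiv.swap 0 3) (by decide) h3
      · exact MConfig.hasSignedFC_perm hl hu (Equiv.swap 0 2 * Equiv.swap 1 3) (by decide) h3
    · refine Or.inr ⟨t, ht, h1, ?_, ?_, ?_, h7, ?_, ?_, ?_⟩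
      · exact MConfig.hasSignedFC_perm hl hu (Equiv.swap 2 3) (by decide) h1
      · exact MConfig.hasSignedFC_perm hl hu (Equiv.swap 1 3) (by decide) h1
      · exact MConfig.hasSignedFC_perm hl hu (Equiv.swap 0 3) (by decide) h1
      · exact MConfig.hasSignedFC_perm hl hu (Equiv.swap 0 1) (by decide) h7
      · exact MConfig.hasSignedFC_perm hl hu (Equiv.swap 0 2) (by decide) h7
      · exact MConfig.hasSignedFC_perm hl hu (Equiv.swap 0 3) (by decide) h7

/-- so the pure-`S₄` seed may be encoded with the orbit-form block. -/
theorem seedS4Static_iff_orbitForm (h : ℤ) :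
    SeedB1DiamondS4Static h ↔
      ∀ C : MConfig, C.InDiamond h → PermClosed C.lower → PermClosed C.upper → C.StaticAll → ¬ FCCoreBlockOrbit C := by
  refine forall_congr' fun C => ?_
  constructor
  · intro H hd hl hu hs hb; exact H hd hl hu hs ((fcCoreBlock_iff_orbit hl hu).2 hb)
  · intro H hd hl hu hs hb; exact H hd hl hu hs ((fcCoreBlock_iff_orbit hl hu).1 hb)

/-! ## §7 Seam to the crux (documentation only): the line attacks `stub_rung_pad4_seedAt`'s design layer; the crux itself is untouched -/

example : Summit.HodgeConjecture.HodgeConjecture.Theses.EightfoldBlochSeeds.BlochSeedDiscOne =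
    Literature.AlgebraicGeometry.HodgeTheory.HasHyperbolicBlochSeed 4 1 := rfl

end Summit.HodgeConjecture.HodgeConjecture.Cruxes.BlochSeedDiscOne.FlipCrossfire
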